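import Literature.Topology.FourManifolds.TrisectionsMorseTransport
import Literature.Topology.FourManifolds.ImmersionOrientation
import Literature.Topology.FourManifolds.MorseProofs
import Mathlib.Analysis.SpecialFunctions.SmoothTransition
import Mathlib.Analysis.Calculus.Deriv.Inv
import Mathlib.Analysis.SpecialFunctions.ExpDeriv

/-!
# Helpers for stub `stub_sectorCores` of line `lp-by-sphere-system-surgery` (crux `AgkCor6Sufficiency`,
item stmt-SmoothPoincare4-10894, routes CongruenceShadows / GroupTrisection; lead reshape r4, Step A)

Pure lemmas for the cored presentation of a Gay–Kirby trisection (`…StubSectorCores.lean`), bundled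
in the registered helper stub `stub_sectorCoresToolkit : SectorCoresToolkit`: (1) the fixed **core
profile** `coreProfile s = smoothTransition (2s - 1/2)` of the line's skeleton (declared here,
verbatim) and its calculus (`≡ 0` below `1/4`, monotone, `= 1/2` exactly at `1/2`, smooth,
`coreProfile' (1/2) ≠ 0` — `smoothTransition` has positive derivative on `(0, 1)`); (2) the inverse
of an equidimensional topological embedding `W⁴ → X⁴` is smooth on a set of immersion points (it is
linear in the charts of `exists_charts_of_isImmersionAt`); (3) a manifold partitioned into three open
pieces is their disjoint union (Mathlib's disjoint-union manifolds); (4) the core `{φ ≤ lev}` of a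
compact `4`-dimensional `1`-handlebody is a compact connected `1`-handlebody (regular sublevel set
of the adapted Morse function with its Morse data, Milnor 1965, Lemma 2.9, `sublevel_morseData`;
connected by Reeb's argument, `IsMorseAdapted.isConnected_preimage_Iic`).

## References

* J. Milnor, *Lectures on the h-cobordism theorem* (1965), Lemma 2.9. [MilnorHCobordism1965]
* J. Milnor, *Morse theory* (1963), §3 and proof of Thm. 4.1. [Milnor1963]
-/

noncomputable section

-- the prescribed namespace `Summit.<P>.<Sub>.…` duplicates `SmoothPoincare4` (P = Sub)
set_option linter.dupNamespace false

open Set Function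
open scoped Manifold ContDiff Topology

namespace Summit.SmoothPoincare4.SmoothPoincare4.Cruxes.AgkCor6Sufficiency.LpBySphereSystemSurgery

open Literature.Topology.FourManifolds

universe u

/-! ## The core profile (verbatim from the skeleton) -/

/-- The fixed **core profile** `β(s) = smoothTransition (2s - 1/2)`: `β ≡ 0` on `[0, 1/4]`,
`β ≡ 1` on `[3/4, 1]`, `β(1/2) = 1/2`; the level function of a cored presentation reads `β` in
the collar coordinate of every sector (lead reshape r4). -/
def coreProfile (s : ℝ) : ℝ := Real.smoothTransition (2 * s - 1 / 2)

/-! ## 1. Calculus of the core profile -/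

section Profile

open Real

/-- `expNegInvGlue` is strictly increasing on `(0, ∞)`. [folklore] -/
theorem expNegInvGlue_lt {x y : ℝ} (hx : 0 < x) (hxy : x < y) :
    expNegInvGlue x < expNegInvGlue y := by
  have hy : 0 < y := hx.trans hxy
  simp only [expNegInvGlue, not_le.2 hx, not_le.2 hy, if_false]
  apply Real.exp_lt_exp.2
  rw [neg_lt_neg_iff]
  exact inv_strictAnti₀ hx hxy

/-- `smoothTransition x < smoothTransition y` for `x < y`, `x < 1`, `0 < y`. [folklore] -/
theorem smoothTransition_lt {x y : ℝ} (hxy : x < y) (hx1 : x < 1) (hy0 : 0 < y) :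
    smoothTransition x < smoothTransition y := by
  rcases le_or_gt x 0 with hx0 | hx0
  · rw [smoothTransition.zero_of_nonpos hx0]
    exact smoothTransition.pos_of_pos hy0
  rcases le_or_gt 1 y with hy1 | hy1
  · rw [smoothTransition.one_of_one_le hy1]
    exact smoothTransition.lt_one_of_lt_one hx1
  have h1 : expNegInvGlue x < expNegInvGlue y := expNegInvGlue_lt hx0 hxy
  have h2 : expNegInvGlue (1 - y) < expNegInvGlue (1 - x) :=
    expNegInvGlue_lt (by linarith) (by linarith)
  have hpx := expNegInvGlue.pos_of_pos hx0
  have hpy := expNegInvGlue.pos_of_pos hy0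
  have hp1x := expNegInvGlue.pos_of_pos (show 0 < 1 - x by linarith)
  have hp1y := expNegInvGlue.pos_of_pos (show 0 < 1 - y by linarith)
  unfold smoothTransition
  rw [div_lt_div_iff₀ (by positivity) (by positivity)]
  nlinarith [mul_lt_mul'' h1 h2 hpx.le hp1y.le]

/-- `smoothTransition (1/2) = 1/2` (symmetry). [folklore] -/
theorem smoothTransition_half : smoothTransition (1 / 2 : ℝ) = 1 / 2 := by
  unfold smoothTransition
  have h : (1 : ℝ) - 1 / 2 = 1 / 2 := by norm_num
  rw [h]
  have hp := expNegInvGlue.pos_of_pos (show (0 : ℝ) < 1 / 2 by norm_num)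
  field_simp
  ring

/-- `coreProfile ≡ 0` on `(-∞, 1/4]`. [folklore] -/
theorem coreProfile_of_le {s : ℝ} (h : s ≤ 1 / 4) : coreProfile s = 0 :=
  smoothTransition.zero_of_nonpos (by linarith)

/-- `coreProfile` is monotone. [folklore] -/
theorem coreProfile_monotone : Monotone coreProfile := fun _ _ h =>
  smoothTransition.monotone (by linarith)

/-- `coreProfile (1/2) = 1/2`. [folklore] -/
theorem coreProfile_half : coreProfile (1 / 2) = 1 / 2 := by
  unfold coreProfile; norm_num [smoothTransition_half]

/-- `coreProfile s < 1/2` for `s < 1/2`. [folklore] -/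
theorem coreProfile_lt_half {s : ℝ} (h : s < 1 / 2) : coreProfile s < 1 / 2 := by
  rw [← coreProfile_half]
  exact smoothTransition_lt (by linarith) (by linarith) (by norm_num)

/-- `1/2 < coreProfile s` for `1/2 < s`. [folklore] -/
theorem half_lt_coreProfile {s : ℝ} (h : 1 / 2 < s) : 1 / 2 < coreProfile s := by
  rw [← coreProfile_half]
  exact smoothTransition_lt (by linarith) (by norm_num) (by linarith)

/-- `coreProfile s ≤ 1/2 ↔ s ≤ 1/2`. [folklore] -/
theorem coreProfile_le_half_iff {s : ℝ} : coreProfile s ≤ 1 / 2 ↔ s ≤ 1 / 2 :=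
  ⟨fun h => not_lt.1 fun h' => (half_lt_coreProfile h').not_ge h,
    fun h => coreProfile_half ▸ coreProfile_monotone h⟩

/-- `1/2 ≤ coreProfile s ↔ 1/2 ≤ s`. [folklore] -/
theorem half_le_coreProfile_iff {s : ℝ} : 1 / 2 ≤ coreProfile s ↔ 1 / 2 ≤ s :=
  ⟨fun h => not_lt.1 fun h' => (coreProfile_lt_half h').not_ge h,
    fun h => coreProfile_half ▸ coreProfile_monotone h⟩

/-- The derivative of `expNegInvGlue` at a positive point. [folklore] -/
theorem hasDerivAt_expNegInvGlue {x : ℝ} (hx : 0 < x) :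
    HasDerivAt expNegInvGlue (Real.exp (-x⁻¹) * (x ^ 2)⁻¹) x := by
  have h : (fun y => Real.exp (-y⁻¹)) =ᶠ[nhds x] expNegInvGlue := by
    filter_upwards [Ioi_mem_nhds hx] with y hy
    simp [expNegInvGlue, not_le.2 (show (0:ℝ) < y from hy)]
  refine HasDerivAt.congr_of_eventuallyEq ?_ h.symm
  have h1 : HasDerivAt (fun y : ℝ => -y⁻¹) ((x ^ 2)⁻¹) x := by
    have := (hasDerivAt_inv hx.ne').fun_neg
    simpa using this
  exact (Real.hasDerivAt_exp _).comp x h1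

/-- **`smoothTransition` has positive derivative on `(0, 1)`.** [folklore] -/
theorem hasDerivAt_smoothTransition_pos {x : ℝ} (hx0 : 0 < x) (hx1 : x < 1) :
    ∃ d : ℝ, 0 < d ∧ HasDerivAt smoothTransition d x := by
  have hx1' : 0 < 1 - x := by linarith
  have he := hasDerivAt_expNegInvGlue hx0
  have he' : HasDerivAt (fun y => expNegInvGlue (1 - y))
      (Real.exp (-(1 - x)⁻¹) * ((1 - x) ^ 2)⁻¹ * (-1)) x :=
    (hasDerivAt_expNegInvGlue hx1').comp x ((hasDerivAt_id x).const_sub 1)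
  have hden := he.add he'
  have hpos : 0 < expNegInvGlue x + expNegInvGlue (1 - x) := smoothTransition.pos_denom x
  have hdiv := he.div hden hpos.ne'
  refine ⟨_, ?_, hdiv⟩
  have hpx := expNegInvGlue.pos_of_pos hx0
  have hp1x := expNegInvGlue.pos_of_pos hx1'
  have h1 : 0 < Real.exp (-x⁻¹) * (x ^ 2)⁻¹ := by positivity
  have h2 : 0 < Real.exp (-(1 - x)⁻¹) * ((1 - x) ^ 2)⁻¹ := by positivity
  apply div_pos _ (by positivity)
  have hnum : Real.exp (-x⁻¹) * (x ^ 2)⁻¹ * (expNegInvGlue x + expNegInvGlue (1 - x)) -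
      expNegInvGlue x * (Real.exp (-x⁻¹) * (x ^ 2)⁻¹ + Real.exp (-(1 - x)⁻¹) * ((1 - x) ^ 2)⁻¹ * -1)
      = Real.exp (-x⁻¹) * (x ^ 2)⁻¹ * expNegInvGlue (1 - x) +
        expNegInvGlue x * (Real.exp (-(1 - x)⁻¹) * ((1 - x) ^ 2)⁻¹) := by ring
  show 0 < Real.exp (-x⁻¹) * (x ^ 2)⁻¹ * (expNegInvGlue x + expNegInvGlue (1 - x)) -
      expNegInvGlue x * (Real.exp (-x⁻¹) * (x ^ 2)⁻¹ + Real.exp (-(1 - x)⁻¹) * ((1 - x) ^ 2)⁻¹ * -1)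
  rw [hnum]
  positivity

/-- **`coreProfile' (1/2) ≠ 0`.** [folklore] -/
theorem hasDerivAt_coreProfile_half : ∃ d : ℝ, d ≠ 0 ∧ HasDerivAt coreProfile d (1 / 2) := by
  obtain ⟨d, hd, h⟩ := hasDerivAt_smoothTransition_pos (x := 1 / 2) (by norm_num) (by norm_num)
  have hinner : HasDerivAt (fun s : ℝ => 2 * s - 1 / 2) 2 (1 / 2) := by
    simpa using ((hasDerivAt_id (1 / 2 : ℝ)).const_mul 2).sub_const (1 / 2)
  refine ⟨d * 2, by positivity, ?_⟩
  exact h.comp_of_eq (1 / 2) hinner (by norm_num)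

/-- `coreProfile` is smooth. [folklore] -/
theorem contDiff_coreProfile : ContDiff ℝ ∞ coreProfile :=
  (smoothTransition.contDiff (n := ⊤)).comp ((contDiff_const.mul contDiff_id).sub contDiff_const)

end Profile

/-! ## 2. The inverse of a sector embedding is smooth off the spine -/

section InverseSmooth

variable {X : Type u} [TopologicalSpace X] [ChartedSpace (EuclideanSpace ℝ (Fin 4)) X]
  {W : Type u} [TopologicalSpace W] [ChartedSpace (EuclideanHalfSpace 4) W] [Nonempty W]

/-- **The inverse of an equidimensional embedding is smooth on a set of immersion points.**
If `e : W → X` is a topological embedding of a `4`-manifold with boundary into a `4`-manifold,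
`U ⊆ range e`, and `e` is a `C^∞` immersion at every point mapped into `U`, then `e⁻¹` is `C^∞`
on `U`: in the charts `(φ, ψ, L)` of `exists_charts_of_isImmersionAt`, `e⁻¹ = φ⁻¹ ∘ L⁻¹ ∘ ψ` on
the open piece `e(source φ)` of `range e`. [folklore] -/
theorem contMDiffOn_invFun_of_isImmersionAt {e : W → X} (he : Topology.IsEmbedding e)
    {U : Set X} (hUr : U ⊆ range e)
    (himm : ∀ w, e w ∈ U → Manifold.IsImmersionAt (𝓡∂ 4) (𝓡 4) ∞ e w) :
    ContMDiffOn (𝓡 4) (𝓡∂ 4) ∞ (Function.invFun e) U := by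
  have hinv : ∀ w, Function.invFun e (e w) = w := Function.leftInverse_invFun he.injective
  apply contMDiffOn_of_locally_contMDiffOn
  intro x hx
  obtain ⟨w, rfl⟩ := hUr hx
  obtain ⟨φ, ψ, L, hφmem, hψmem, hwφ, hsrc, -, -, hΘe⟩ :=
    exists_charts_of_isImmersionAt (himm w hx)
  obtain ⟨O, hO, hOe⟩ := he.isInducing.isOpen_iff.1 φ.open_source
  refine ⟨O, hO, by rw [← hOe] at hwφ; exact hwφ, ?_⟩
  set Θ₀ : X → EuclideanSpace ℝ (Fin 4) := fun q => L.symm (ψ q) with hΘ₀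
  have hΘ₀s : ContMDiffOn (𝓡 4) 𝓘(ℝ, EuclideanSpace ℝ (Fin 4)) ∞ Θ₀ ψ.source :=
    (contMDiff_iff_contDiff.2 L.symm.contDiff).comp_contMDiffOn
      (contMDiffOn_of_mem_maximalAtlas hψmem)
  have hsymm : ContMDiffOn 𝓘(ℝ, EuclideanSpace ℝ (Fin 4)) (𝓡∂ 4) ∞ (φ.extend (𝓡∂ 4)).symm
      (φ.extend (𝓡∂ 4)).target := by
    rw [OpenPartialHomeomorph.extend_target']
    exact contMDiffOn_extend_symm hφmem
  have hcomp : ContMDiffOn (𝓡 4) (𝓡∂ 4) ∞ ((φ.extend (𝓡∂ 4)).symm ∘ Θ₀)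
      (ψ.source ∩ Θ₀ ⁻¹' (φ.extend (𝓡∂ 4)).target) :=
    hsymm.comp (hΘ₀s.mono inter_subset_left) fun q hq => hq.2
  have hsub : U ∩ O ⊆ ψ.source ∩ Θ₀ ⁻¹' (φ.extend (𝓡∂ 4)).target := by
    intro y hy
    obtain ⟨w', rfl⟩ := hUr hy.1
    have hw'φ : w' ∈ φ.source := by rw [← hOe]; exact hy.2
    refine ⟨hsrc hw'φ, ?_⟩
    show L.symm (ψ (e w')) ∈ (φ.extend (𝓡∂ 4)).target
    rw [(hΘe w' hw'φ).1]; exact (hΘe w' hw'φ).2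
  refine (hcomp.mono hsub).congr ?_
  intro y hy
  obtain ⟨w', rfl⟩ := hUr hy.1
  have hw'φ : w' ∈ φ.source := by rw [← hOe]; exact hy.2
  rw [hinv]
  show w' = (φ.extend (𝓡∂ 4)).symm (L.symm (ψ (e w')))
  rw [(hΘe w' hw'φ).1]
  exact ((φ.extend (𝓡∂ 4)).left_inv (by rw [OpenPartialHomeomorph.extend_source]; exact hw'φ)).symm

end InverseSmooth

/-! ## 3. A manifold partitioned into three open pieces is their disjoint union -/

section Partition

variable {E H : Type*} [NormedAddCommGroup E] [NormedSpace ℝ E] [TopologicalSpace H]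
  {I : ModelWithCorners ℝ E H} {M : Type u} [TopologicalSpace M] [ChartedSpace H M]
  {N : Type*} [TopologicalSpace N] [ChartedSpace H N]

open TopologicalSpace

/-- A map which agrees on an open set `U ∋ x` with a smooth map of `U` is smooth at `x`. [folklore] -/
theorem contMDiffAt_of_eq_on_opens {U : Opens M} {F : M → N} {x : M} (hx : x ∈ U) {G : U → N}
    (hG : ContMDiff I I ∞ G) (h : ∀ y : U, F y = G y) : ContMDiffAt I I ∞ F x :=
  (contMDiffAt_subtype_iff (U := U) (x := ⟨x, hx⟩)).1
    (by rw [show (fun y : U => F y) = G from funext h]; exact hG.contMDiffAt)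

/-- **A manifold partitioned into three open sets is diffeomorphic to the disjoint union of the
pieces** (Mathlib's disjoint-union manifolds: the charts of `U₀ ⊕ (U₁ ⊕ U₂)` are the lifted
charts of the pieces, which are the restricted charts of `M`). [folklore] -/
theorem nonempty_diffeomorph_of_partition (U₀ U₁ U₂ : Opens M)
    (hcov : ∀ x, x ∈ U₀ ∨ x ∈ U₁ ∨ x ∈ U₂) (h₀₁ : Disjoint (U₀ : Set M) U₁)
    (h₀₂ : Disjoint (U₀ : Set M) U₂) (h₁₂ : Disjoint (U₁ : Set M) U₂) :
    Nonempty (M ≃ₘ^∞⟮I, I⟯ (U₀ ⊕ (U₁ ⊕ U₂))) := by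
  classical
  have h10 : ∀ y : U₁, (y : M) ∉ U₀ := fun y h => h₀₁.le_bot ⟨h, y.2⟩
  have h20 : ∀ y : U₂, (y : M) ∉ U₀ := fun y h => h₀₂.le_bot ⟨h, y.2⟩
  have h21 : ∀ y : U₂, (y : M) ∉ U₁ := fun y h => h₁₂.le_bot ⟨h, y.2⟩
  exact
   ⟨{ toFun := fun x => if h0 : x ∈ U₀ then Sum.inl ⟨x, h0⟩ else if h1 : x ∈ U₁ then
        Sum.inr (Sum.inl ⟨x, h1⟩) else
        Sum.inr (Sum.inr ⟨x, ((hcov x).resolve_left h0).resolve_left h1⟩)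
      invFun := Sum.elim Subtype.val (Sum.elim Subtype.val Subtype.val)
      left_inv := fun x => by
        by_cases h0 : x ∈ U₀
        · simp [h0]
        by_cases h1 : x ∈ U₁ <;> simp [h0, h1]
      right_inv := by
        rintro (y | y | y)
        · simp [y.2]
        · simp [h10 y, y.2]
        · simp [h20 y, h21 y]
      contMDiff_toFun := fun x => by
        rcases hcov x with h0 | h1 | h2
        · exact contMDiffAt_of_eq_on_opens h0 ContMDiff.inl fun y => by simp [y.2]
        · exact contMDiffAt_of_eq_on_opens h1 (ContMDiff.inr.comp ContMDiff.inl) fun y => by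
            simp [h10 y, y.2]
        · exact contMDiffAt_of_eq_on_opens h2 (ContMDiff.inr.comp ContMDiff.inr) fun y => by
            simp [h20 y, h21 y]
      contMDiff_invFun :=
        contMDiff_subtype_val.sumElim (contMDiff_subtype_val.sumElim contMDiff_subtype_val) }⟩

end Partition

/-! ## 4. The core of a sector: a regular sublevel set of its adapted Morse function -/

section Core

variable {W : Type u} [TopologicalSpace W] [CompactSpace W]
  [ChartedSpace (EuclideanHalfSpace 4) W] [IsManifold (𝓡∂ 4) ∞ W]

/-- **The core `{φ ≤ lev}` of a compact `4`-dimensional `1`-handlebody is a compact connected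
`1`-handlebody.**  For a Morse function `φ` adapted to `∂W` with handle numbers `(1, k, 0, …)`
and a level `lev < 1` above all critical values, the sublevel set `{φ ≤ lev}` with the
structure `sublevelAtlas` is a smooth manifold with boundary, smoothly embedded by the
inclusion, on which `φ + (1 - lev)` is an adapted Morse function with the critical points and
indices of `φ` (Milnor 1965, Lemma 2.9 with the Morse data: `sublevel_morseData`); it is
compact, and connected by Reeb's argument (one critical point of index `0`,
`IsMorseAdapted.isConnected_preimage_Iic`). [cite: MilnorHCobordism1965, Lemma 2.9] -/
theorem core_package {φ : W → ℝ} (hφ : IsMorseAdapted (𝓡∂ 4) φ) {k : ℕ}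
    (hcount : ∀ j, (criticalSetOfIndex (𝓡∂ 4) φ j).ncard = handleCount 1 k j)
    {lev : ℝ} (hlev : lev < 1)
    (hint : ∀ p, φ p ≤ lev → (𝓡∂ 4).IsInteriorPoint p)
    (hreg : ∀ p, φ p = lev → ¬ IsMCriticalPt (𝓡∂ 4) φ p)
    (hregle : ∀ p, IsMCriticalPt (𝓡∂ 4) φ p → φ p < lev) :
    letI := (sublevelAtlas hφ.1.1 lev hint hreg).chartedSpace
    IsManifold (𝓡∂ 4) ∞ ↥(φ ⁻¹' Iic lev) ∧
    Manifold.IsSmoothEmbedding (𝓡∂ 4) (𝓡∂ 4) ∞ (Subtype.val : ↥(φ ⁻¹' Iic lev) → W) ∧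
    IsHandlebodyOfIndexLE 3 1 ↥(φ ⁻¹' Iic lev) ∧
    CompactSpace ↥(φ ⁻¹' Iic lev) ∧ ConnectedSpace ↥(φ ⁻¹' Iic lev) := by
  obtain ⟨hint', hreg', hM, hval, hadapt, hcrit, hidx⟩ :=
    sublevel_morseData (k := 3) (by norm_num) hφ hlev fun z hz h => (hregle z hz).ne h
  letI := (sublevelAtlas hφ.1.1 lev hint hreg).chartedSpace
  have hfin : (criticalSet (𝓡∂ 4) φ).Finite := IsMorse.finite_criticalSet_holds hφ.1
  have hidxφ : ∀ z, IsMCriticalPt (𝓡∂ 4) φ z → morseIndex (𝓡∂ 4) φ z ≤ 1 := by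
    intro z hz
    by_contra hlt
    rw [not_le] at hlt
    have hfin' : (criticalSetOfIndex (𝓡∂ 4) φ (morseIndex (𝓡∂ 4) φ z)).Finite :=
      hfin.subset (criticalSetOfIndex_subset _ φ _)
    have hempty : criticalSetOfIndex (𝓡∂ 4) φ (morseIndex (𝓡∂ 4) φ z) = ∅ := by
      rw [← Set.ncard_eq_zero hfin', hcount, handleCount_of_two_le _ _ hlt]
    have hzmem : z ∈ criticalSetOfIndex (𝓡∂ 4) φ (morseIndex (𝓡∂ 4) φ z) := ⟨hz, rfl⟩
    rw [hempty] at hzmem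
    exact hzmem
  have hclosed : IsClosed (φ ⁻¹' Iic lev) := isClosed_Iic.preimage hφ.1.1.continuous
  haveI hcomp : CompactSpace ↥(φ ⁻¹' Iic lev) := isCompact_iff_compactSpace.1 hclosed.isCompact
  have h1 : (criticalSetOfIndex (𝓡∂ 4) φ 0).ncard = 1 := by rw [hcount]; rfl
  obtain ⟨p, hp⟩ := Set.ncard_eq_one.1 h1
  have h0 : (criticalSetOfIndex (𝓡∂ 4) φ 0).Subsingleton := by
    rw [hp]; exact subsingleton_singleton
  have hne : (φ ⁻¹' Iic lev).Nonempty := by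
    have hpc : IsMCriticalPt (𝓡∂ 4) φ p := by
      have : p ∈ criticalSetOfIndex (𝓡∂ 4) φ 0 := by rw [hp]; exact mem_singleton p
      exact this.1
    exact ⟨p, (hregle p hpc).le⟩
  haveI : ConnectedSpace ↥(φ ⁻¹' Iic lev) :=
    isConnected_iff_connectedSpace.1 (hφ.isConnected_preimage_Iic h0 hlev hne)
  refine ⟨hM, hval, ⟨fun x => φ x + (1 - lev), hadapt, fun z hz => ?_⟩, hcomp, inferInstance⟩
  have hz' := (hcrit z).1 hz
  rw [hidx z hz']
  exact hidxφ z.1 hz'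

end Core

/-! ## 5. The registered helper stub -/

/-- **The toolkit of the cored presentation** (registered helper stub of `stub_sectorCores`):
(1) the calculus of `coreProfile`; (2) smoothness of the inverse of an equidimensional embedding
on a set of immersion points; (3) three-piece partitions of `4`-manifolds with boundary;
(4) cores of compact `4`-dimensional `1`-handlebodies.  (A conjunction of statements PROVED
in this file — `stub_sectorCoresToolkit` —, not a named fact.) -/
def SectorCoresToolkit : Prop :=
  ((∀ s : ℝ, s ≤ 1 / 4 → coreProfile s = 0) ∧ Monotone coreProfile ∧
    (∀ s : ℝ, coreProfile s ≤ 1 / 2 ↔ s ≤ 1 / 2) ∧ (∀ s : ℝ, 1 / 2 ≤ coreProfile s ↔ 1 / 2 ≤ s) ∧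
    (∃ d : ℝ, d ≠ 0 ∧ HasDerivAt coreProfile d (1 / 2)) ∧ ContDiff ℝ ∞ coreProfile) ∧
  (∀ (X : Type) [TopologicalSpace X] [ChartedSpace (EuclideanSpace ℝ (Fin 4)) X]
    (W : Type) [TopologicalSpace W] [ChartedSpace (EuclideanHalfSpace 4) W] [Nonempty W]
    (e : W → X), Topology.IsEmbedding e → ∀ U : Set X, U ⊆ range e →
    (∀ w, e w ∈ U → Manifold.IsImmersionAt (𝓡∂ 4) (𝓡 4) ∞ e w) →
    ContMDiffOn (𝓡 4) (𝓡∂ 4) ∞ (Function.invFun e) U) ∧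
  (∀ (M : Type) [TopologicalSpace M] [ChartedSpace (EuclideanHalfSpace 4) M]
    (U₀ U₁ U₂ : TopologicalSpace.Opens M), (∀ x, x ∈ U₀ ∨ x ∈ U₁ ∨ x ∈ U₂) →
    Disjoint (U₀ : Set M) U₁ → Disjoint (U₀ : Set M) U₂ → Disjoint (U₁ : Set M) U₂ →
    Nonempty (M ≃ₘ^∞⟮𝓡∂ 4, 𝓡∂ 4⟯ (U₀ ⊕ (U₁ ⊕ U₂)))) ∧
  (∀ (W : Type) [TopologicalSpace W] [CompactSpace W] [ChartedSpace (EuclideanHalfSpace 4) W]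
    [IsManifold (𝓡∂ 4) ∞ W] (φ : W → ℝ) (hφ : IsMorseAdapted (𝓡∂ 4) φ) (k : ℕ)
    (_ : ∀ j, (criticalSetOfIndex (𝓡∂ 4) φ j).ncard = handleCount 1 k j)
    (lev : ℝ) (_ : lev < 1) (hint : ∀ p, φ p ≤ lev → (𝓡∂ 4).IsInteriorPoint p)
    (hreg : ∀ p, φ p = lev → ¬ IsMCriticalPt (𝓡∂ 4) φ p)
    (_ : ∀ p, IsMCriticalPt (𝓡∂ 4) φ p → φ p < lev),
    letI := (sublevelAtlas hφ.1.1 lev hint hreg).chartedSpace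
    IsManifold (𝓡∂ 4) ∞ ↥(φ ⁻¹' Iic lev) ∧
    Manifold.IsSmoothEmbedding (𝓡∂ 4) (𝓡∂ 4) ∞ (Subtype.val : ↥(φ ⁻¹' Iic lev) → W) ∧
    IsHandlebodyOfIndexLE 3 1 ↥(φ ⁻¹' Iic lev) ∧
    CompactSpace ↥(φ ⁻¹' Iic lev) ∧ ConnectedSpace ↥(φ ⁻¹' Iic lev))

/-- **Registered helper stub `stub_sectorCoresToolkit`** of line `lp-by-sphere-system-surgery`
(toolkit for the cored presentation `stub_sectorCores`). [cite: MilnorHCobordism1965, Lemma 2.9] -/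
theorem stub_sectorCoresToolkit : SectorCoresToolkit :=
  ⟨⟨fun _ => coreProfile_of_le, coreProfile_monotone, fun _ => coreProfile_le_half_iff,
      fun _ => half_le_coreProfile_iff, hasDerivAt_coreProfile_half, contDiff_coreProfile⟩,
    fun _ _ _ _ _ _ _ _ he _ hU himm => contMDiffOn_invFun_of_isImmersionAt he hU himm,
    fun _ _ _ U₀ U₁ U₂ hcov h₀₁ h₀₂ h₁₂ => nonempty_diffeomorph_of_partition U₀ U₁ U₂ hcov h₀₁ h₀₂ h₁₂,
    fun _ _ _ _ _ _ hφ _ hcount _ hlev hint hreg hregle =>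
      core_package hφ hcount hlev hint hreg hregle⟩

end Summit.SmoothPoincare4.SmoothPoincare4.Cruxes.AgkCor6Sufficiency.LpBySphereSystemSurgery

end
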